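import Summits.KontsevichZagierPeriods.KontsevichZagierPeriods.Theorems.LinRedNormalFormArrangementNormalFormStubRebaseSimplePosOnePosQuadClose
import Summits.KontsevichZagierPeriods.KontsevichZagierPeriods.Theorems.LinRedNormalFormArrangementNormalFormStubRebaseSimplePosOnePosQuadChart

/-!
# Stub `stub_rebaseSimplePosOnePos` (crux `ArrangementNormalForm`, line `janus-bands`) —
part `QuadLocal`: localising a flat cell at its flat point (`B = 2`)

`B = 2` corner calculus. For the data of `Hpar` over a product cell
`{x'-rows M₀} × (ylo(x'), yhi(x'))` of the base `(x₁, x₂, y)` whose height `h = yhi − ylo` and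
width `w = v − u` have INDEPENDENT linear parts (the dependent case is part `ParFlatDep`), the
flat locus `{h = w = 0}` is the single rational point `x'₀ = RebasePos.flatPtQ h w` of the silent
plane (Cramer's rule, `RebasePos.flatPtQ_spec`). `RebasePos.good_quadCell_of_inner` cuts the
`x'`-cell by the four rows of the square box of radius `r` around `x'₀` (rule 1a,
`RebasePos.cutCell`): the four outer pieces contain no flat point on their closed cells and are
closed by `RebasePos.good_parCell_of_noFlat` (part `Flats`); what is left is the INNER piece
(hypothesis `Hinner`, any rational `r > 0`), over which the later files normalise, separate the
far factors and blow up. Also: the rational consequences of a quadruple point on the closed cell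
(`RebasePos.quad_at_flatPt`: `h`, `w`, `κ' = u₀ + s ℓ₂` and `a = ylo − ℓ₂` vanish at `x'₀`).

References: M. Kontsevich, D. Zagier, *Periods* (2001), §1.2, rule (1a).
-/

noncomputable section

open Set MeasureTheory MvPolynomial
open Literature.NumberTheory.Transcendental Literature.ModelTheory.ExponentialFields

namespace Summit.KontsevichZagierPeriods.ArrangementNormalForm.JanusBands

namespace RebasePos

open SeparatePos

section QuadLocal

variable {m m' m₀ : ℕ} (L : Fin m → (Fin 2 → ℚ) × ℚ) (e : Fin m → ℕ) (ℓ₁ ℓ₂ : (Fin 2 → ℚ) × ℚ)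

/-- The determinant of the linear parts of two `x'`-forms over the silent plane. -/
def detQ (hF wF : (Fin 2 → ℚ) × ℚ) : ℚ := hF.1 0 * wF.1 1 - hF.1 1 * wF.1 0

/-- Cramer's rule: the common zero of two `x'`-forms with independent linear parts. -/
def flatPtQ (hF wF : (Fin 2 → ℚ) × ℚ) : Fin 2 → ℚ :=
  ![(-hF.2 * wF.1 1 + wF.2 * hF.1 1) / detQ hF wF, (-wF.2 * hF.1 0 + hF.2 * wF.1 0) / detQ hF wF]

/-- A common zero of two independent `x'`-forms is the flat point. -/
theorem flatPtQ_spec (hF wF : (Fin 2 → ℚ) × ℚ) (hdet : detQ hF wF ≠ 0) (z : Fin (2 + 1 + 1) → ℝ)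
    (h1 : affB 2 1 hF z = 0) (h2 : affB 2 1 wF z = 0) :
    z 0 = (flatPtQ hF wF 0 : ℝ) ∧ z 1 = (flatPtQ hF wF 1 : ℝ) := by
  have hd : (detQ hF wF : ℝ) ≠ 0 := by exact_mod_cast hdet
  rw [detQ] at hd
  push_cast at hd
  rw [affB_three] at h1 h2
  simp only [flatPtQ, detQ, Matrix.cons_val_zero, Matrix.cons_val_one]
  push_cast
  constructor
  · rw [eq_div_iff hd]
    linear_combination (wF.1 1 : ℝ) * h1 - (hF.1 1 : ℝ) * h2
  · rw [eq_div_iff hd]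
    linear_combination -(wF.1 0 : ℝ) * h1 + (hF.1 0 : ℝ) * h2

/-- An `x'`-form vanishing at a point with the coordinates of the flat point vanishes at the
(rational) flat point. -/
theorem affB_flatPt_eq_zero (hF wF d : (Fin 2 → ℚ) × ℚ) (z : Fin (2 + 1 + 1) → ℝ)
    (hz : z 0 = (flatPtQ hF wF 0 : ℝ) ∧ z 1 = (flatPtQ hF wF 1 : ℝ)) (hd : affB 2 1 d z = 0) :
    d.1 0 * flatPtQ hF wF 0 + d.1 1 * flatPtQ hF wF 1 + d.2 = 0 := by
  rw [affB_three, hz.1, hz.2] at hd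
  exact_mod_cast hd

/-- **A quadruple point sits at the flat point.** If the closed cell contains a point where
`ylo = yhi`, `u = v`, `u₀ + s ℓ₂ = 0` and `ylo = ℓ₂`, and height and width are independent, then
the four `x'`-forms `yhi − ylo`, `v − u` (restricted), `u₀ + s ℓ₂`, `ylo − ℓ₂` vanish at the
rational point `flatPtQ`. -/
theorem quad_at_flatPt (M : Fin m' → (Fin (2 + 1) → ℚ) × ℚ) (ylo yhi : (Fin 2 → ℚ) × ℚ) (u v : (Fin (2 + 1) → ℚ) × ℚ)
    (hpar : u.1 (Fin.last 2) = v.1 (Fin.last 2)) (hdet : detQ (yhi - ylo) (restr 2 v - restr 2 u) ≠ 0)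
    (hquad : ∃ z ∈ closure {z : Fin (2 + 1 + 1) → ℝ | ∀ j, 0 < affF 2 1 (M j) z},
      affB 2 1 ylo z = affB 2 1 yhi z ∧ affF 2 1 u z = affF 2 1 v z ∧
        affB 2 1 (restr 2 u) z + (u.1 (Fin.last 2) : ℝ) * affB 2 1 ℓ₂ z = 0 ∧ affB 2 1 ylo z = affB 2 1 ℓ₂ z) :
    ∀ d : (Fin 2 → ℚ) × ℚ, (d = yhi - ylo ∨ d = restr 2 v - restr 2 u ∨ d = restr 2 u - (-u.1 (Fin.last 2)) • ℓ₂ ∨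
      d = ylo - ℓ₂) → d.1 0 * flatPtQ (yhi - ylo) (restr 2 v - restr 2 u) 0 +
        d.1 1 * flatPtQ (yhi - ylo) (restr 2 v - restr 2 u) 1 + d.2 = 0 := by
  obtain ⟨z, -, h1, h2, h3, h4⟩ := hquad
  have hh : affB 2 1 (yhi - ylo) z = 0 := by rw [affB_sub, h1, sub_self]
  have hw : affB 2 1 (restr 2 v - restr 2 u) z = 0 := by rw [affB_sub, ← width_eq u v hpar, h2, sub_self]
  have h3' : affB 2 1 (restr 2 u) z + (u.1 2 : ℝ) * affB 2 1 ℓ₂ z = 0 := h3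
  have hk : affB 2 1 (restr 2 u - (-u.1 (Fin.last 2)) • ℓ₂) z = 0 := by
    rw [affB_sub, affB_smul', show (Fin.last 2 : Fin (2 + 1)) = 2 from rfl]; push_cast; linarith
  have ha : affB 2 1 (ylo - ℓ₂) z = 0 := by rw [affB_sub, h4, sub_self]
  have hz := flatPtQ_spec _ _ hdet z hh hw
  intro d hd
  rcases hd with rfl | rfl | rfl | rfl
  · exact affB_flatPt_eq_zero _ _ _ z hz hh
  · exact affB_flatPt_eq_zero _ _ _ z hz hw
  · exact affB_flatPt_eq_zero _ _ _ z hz hk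
  · exact affB_flatPt_eq_zero _ _ _ z hz ha

/-- The four rows of the square box of radius `r` around a rational point `X` of the silent
plane: `x₁ > X₀ − r`, `x₁ < X₀ + r`, `x₂ > X₁ − r`, `x₂ < X₁ + r`. -/
def boxAtQ (X : Fin 2 → ℚ) (r : ℚ) : Fin 4 → (Fin 2 → ℚ) × ℚ :=
  ![(![1, 0], r - X 0), (![-1, 0], r + X 0), (![0, 1], r - X 1), (![0, -1], r + X 1)]

/-- Outside one of the box rows, the corresponding coordinate stays away from the centre. -/
theorem boxAtQ_far (X : Fin 2 → ℚ) (r : ℚ) (hr : 0 < r) (k : Fin 4) (z : Fin (2 + 1 + 1) → ℝ)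
    (hz : affB 2 1 (boxAtQ X r k) z ≤ 0) : ¬ (z 0 = (X 0 : ℝ) ∧ z 1 = (X 1 : ℝ)) := by
  rintro ⟨h0, h1⟩
  have hr' : (0 : ℝ) < r := by exact_mod_cast hr
  fin_cases k <;> simp [boxAtQ, affB_three] at hz <;> linarith

/-- **Localising a flat cell at its flat point** (`B = 2`). Data of `Hpar` over a product cell
(`hsec`) with independent height and width (`hdet`): `[s]` is congruent modulo `KZ.relations` to
the subgroup generated by `GG 2 2 1` as soon as (`Hinner`) this holds for its restriction to the
square box of radius `r` around the flat point, presented with the four box rows appended one by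
one (`RebasePos.cutCell`); the four outer pieces are `good_parCell_of_noFlat`. -/
theorem good_quadCell_of_inner (s : KZ.IntegralRep (2 + 1 + 1)) (M : Fin m' → (Fin (2 + 1) → ℚ) × ℚ)
    (M₀ : Fin m₀ → (Fin 2 → ℚ) × ℚ) (ylo yhi : (Fin 2 → ℚ) × ℚ) (p : MvPolynomial (Fin 2) ℚ)
    (u v : (Fin (2 + 1) → ℚ) × ℚ) (hbd : Bornology.IsBounded s.domain)
    (hdom : s.domain = gDom 2 1 m' M (fun _ => Sum.inr u) (fun _ => Sum.inr v))
    (hint : EqOn s.integrand (glit 2 1 p L e ℓ₁ ℓ₂ 0 1 (fun _ => some 0)) s.domain)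
    (hu : u.1 (Fin.last 2) ≠ 0) (hpar : u.1 (Fin.last 2) = v.1 (Fin.last 2))
    (hcell : ∀ z : Fin (2 + 1 + 1) → ℝ, (∀ j, 0 < affF 2 1 (M j) z) → 0 < affF 2 1 u z ∧ affF 2 1 u z < affF 2 1 v z)
    (hsec : ∀ z : Fin (2 + 1 + 1) → ℝ, (∀ j, 0 < affF 2 1 (M j) z) ↔ ((∀ j, 0 < affB 2 1 (M₀ j) z) ∧
      affB 2 1 ylo z < z (Fin.castAdd 1 (Fin.last 2)) ∧ z (Fin.castAdd 1 (Fin.last 2)) < affB 2 1 yhi z))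
    (hdet : detQ (yhi - ylo) (restr 2 v - restr 2 u) ≠ 0) (r : ℚ) (hr : 0 < r)
    (Hinner : ∀ (s' : KZ.IntegralRep (2 + 1 + 1)), s'.domain ⊆ s.domain → s'.integrand = s.integrand →
      s'.domain = gDom 2 1 (m' + 1 + 1 + 1 + 1)
        (Fin.snoc (Fin.snoc (Fin.snoc (Fin.snoc M (liftX (boxAtQ (flatPtQ (yhi - ylo) (restr 2 v - restr 2 u)) r 0)))
          (liftX (boxAtQ (flatPtQ (yhi - ylo) (restr 2 v - restr 2 u)) r 1)))
          (liftX (boxAtQ (flatPtQ (yhi - ylo) (restr 2 v - restr 2 u)) r 2)))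
          (liftX (boxAtQ (flatPtQ (yhi - ylo) (restr 2 v - restr 2 u)) r 3)))
        (fun _ => Sum.inr u) (fun _ => Sum.inr v) →
      (∀ z : Fin (2 + 1 + 1) → ℝ, (∀ j, 0 < affF 2 1 ((Fin.snoc (Fin.snoc (Fin.snoc (Fin.snoc M
          (liftX (boxAtQ (flatPtQ (yhi - ylo) (restr 2 v - restr 2 u)) r 0)))
          (liftX (boxAtQ (flatPtQ (yhi - ylo) (restr 2 v - restr 2 u)) r 1)))
          (liftX (boxAtQ (flatPtQ (yhi - ylo) (restr 2 v - restr 2 u)) r 2)))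
          (liftX (boxAtQ (flatPtQ (yhi - ylo) (restr 2 v - restr 2 u)) r 3)) : Fin (m' + 1 + 1 + 1 + 1) → _) j) z) ↔
        ((∀ j, 0 < affB 2 1 ((Fin.snoc (Fin.snoc (Fin.snoc (Fin.snoc M₀
          (boxAtQ (flatPtQ (yhi - ylo) (restr 2 v - restr 2 u)) r 0))
          (boxAtQ (flatPtQ (yhi - ylo) (restr 2 v - restr 2 u)) r 1))
          (boxAtQ (flatPtQ (yhi - ylo) (restr 2 v - restr 2 u)) r 2))
          (boxAtQ (flatPtQ (yhi - ylo) (restr 2 v - restr 2 u)) r 3) : Fin (m₀ + 1 + 1 + 1 + 1) → _) j) z) ∧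
          affB 2 1 ylo z < z (Fin.castAdd 1 (Fin.last 2)) ∧ z (Fin.castAdd 1 (Fin.last 2)) < affB 2 1 yhi z)) →
      ∃ c ∈ AddSubgroup.closure (GGset 2 2 1), KZ.of s' - c ∈ KZ.relations) :
    ∃ c ∈ AddSubgroup.closure (GGset 2 2 1), KZ.of s - c ∈ KZ.relations := by
  set hF : (Fin 2 → ℚ) × ℚ := yhi - ylo with hhF
  set wF : (Fin 2 → ℚ) × ℚ := restr 2 v - restr 2 u with hwF
  set X : Fin 2 → ℚ := flatPtQ hF wF with hX
  have hhz : ∀ z : Fin (2 + 1 + 1) → ℝ, affB 2 1 hF z = affB 2 1 yhi z - affB 2 1 ylo z := fun z => by rw [hhF, affB_sub]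
  have hwz : ∀ z : Fin (2 + 1 + 1) → ℝ, affB 2 1 wF z = affF 2 1 v z - affF 2 1 u z := fun z => by
    rw [hwF, affB_sub, width_eq u v hpar]
  -- a flat point is the flat point
  have hflat : ∀ z : Fin (2 + 1 + 1) → ℝ, affB 2 1 ylo z = affB 2 1 yhi z → affF 2 1 u z = affF 2 1 v z →
      z 0 = (X 0 : ℝ) ∧ z 1 = (X 1 : ℝ) := fun z h1 h2 =>
    flatPtQ_spec hF wF hdet z (by rw [hhz, h1, sub_self]) (by rw [hwz, h2, sub_self])
  -- the box rows are non-zero forms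
  have hg : ∀ k, boxAtQ X r k ≠ 0 := fun k h => by
    have := congrArg (fun q : (Fin 2 → ℚ) × ℚ => (q.1 0, q.1 1)) h
    fin_cases k <;> simp [boxAtQ] at this
  -- the generic step: cut by one box row; the outer piece has no flat point
  have step : ∀ {n n₀ : ℕ} (t : KZ.IntegralRep (2 + 1 + 1)) (N : Fin n → (Fin (2 + 1) → ℚ) × ℚ)
      (N₀ : Fin n₀ → (Fin 2 → ℚ) × ℚ), t.domain ⊆ s.domain → t.integrand = s.integrand →
      t.domain = gDom 2 1 n N (fun _ => Sum.inr u) (fun _ => Sum.inr v) →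
      (∀ z : Fin (2 + 1 + 1) → ℝ, (∀ j, 0 < affF 2 1 (N j) z) ↔ ((∀ j, 0 < affB 2 1 (N₀ j) z) ∧
        affB 2 1 ylo z < z (Fin.castAdd 1 (Fin.last 2)) ∧ z (Fin.castAdd 1 (Fin.last 2)) < affB 2 1 yhi z)) →
      (∀ z : Fin (2 + 1 + 1) → ℝ, (∀ j, 0 < affF 2 1 (N j) z) → ∀ j, 0 < affF 2 1 (M j) z) →
      ∀ k : Fin 4, (∀ (t' : KZ.IntegralRep (2 + 1 + 1)), t'.domain ⊆ s.domain → t'.integrand = s.integrand →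
        t'.domain = gDom 2 1 (n + 1) (Fin.snoc N (liftX (boxAtQ X r k))) (fun _ => Sum.inr u) (fun _ => Sum.inr v) →
        (∀ z : Fin (2 + 1 + 1) → ℝ, (∀ j, 0 < affF 2 1 ((Fin.snoc N (liftX (boxAtQ X r k)) : Fin (n + 1) → _) j) z) ↔
          ((∀ j, 0 < affB 2 1 ((Fin.snoc N₀ (boxAtQ X r k) : Fin (n₀ + 1) → _) j) z) ∧
            affB 2 1 ylo z < z (Fin.castAdd 1 (Fin.last 2)) ∧ z (Fin.castAdd 1 (Fin.last 2)) < affB 2 1 yhi z)) →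
        (∀ z : Fin (2 + 1 + 1) → ℝ, (∀ j, 0 < affF 2 1 ((Fin.snoc N (liftX (boxAtQ X r k)) : Fin (n + 1) → _) j) z) →
          ∀ j, 0 < affF 2 1 (M j) z) →
        ∃ c ∈ AddSubgroup.closure (GGset 2 2 1), KZ.of t' - c ∈ KZ.relations) →
      ∃ c ∈ AddSubgroup.closure (GGset 2 2 1), KZ.of t - c ∈ KZ.relations := by
    intro n n₀ t N N₀ hsub hi hd hsec' hbase k Hk
    obtain ⟨t₁, t₂, hsub₁, hsub₂, hi₁, hi₂, hd₁, hd₂, hsec₁, hsec₂, hrel⟩ := cutCell t N N₀ ylo yhi u v hd hsec' _ (hg k)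
    refine good_of_split hrel (Hk t₁ (hsub₁.trans hsub) (hi₁.trans hi) hd₁ hsec₁ fun z hz => hbase z (rows_snoc hz).1) ?_
    -- the outer piece: no flat point on the closed cell
    refine good_parCell_of_noFlat L e ℓ₁ ℓ₂ t₂ _ (Fin.snoc N₀ (-boxAtQ X r k)) ylo yhi p u v (hbd.subset (hsub₂.trans hsub))
      hd₂ (by rw [hi₂, hi]; exact hint.mono (hsub₂.trans hsub)) hu hpar (fun z hz => hcell z (hbase z (rows_snoc hz).1)) hsec₂
      fun z hz h1 h2 => ?_
    have hle : affB 2 1 (boxAtQ X r k) z ≤ 0 :=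
      le_of_closure_rows (continuous_affB_one _) continuous_const (fun w hw => by
        have h := (rows_snoc hw).2
        rw [affF_neg', affF_liftX] at h
        linarith) z hz
    exact boxAtQ_far X r hr k z hle (hflat z h1 h2)
  -- four cuts
  refine step s M M₀ Subset.rfl rfl hdom hsec (fun z hz => hz) 0 fun t₁ hs₁ hi₁ hd₁ hsec₁ hb₁ => ?_
  refine step t₁ _ _ hs₁ hi₁ hd₁ hsec₁ hb₁ 1 fun t₂ hs₂ hi₂ hd₂ hsec₂ hb₂ => ?_
  refine step t₂ _ _ hs₂ hi₂ hd₂ hsec₂ hb₂ 2 fun t₃ hs₃ hi₃ hd₃ hsec₃ hb₃ => ?_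
  refine step t₃ _ _ hs₃ hi₃ hd₃ hsec₃ hb₃ 3 fun t₄ hs₄ hi₄ hd₄ hsec₄ _ => ?_
  exact Hinner t₄ hs₄ hi₄ hd₄ hsec₄

end QuadLocal

end RebasePos

/-- **Registered part of `stub_rebaseSimplePosOnePos` (line `janus-bands`, `B = 2` corner
calculus): Cramer's rule for the flat point.** A common zero of two `x'`-forms over the silent
plane `(x₁, x₂)` with independent linear parts is the rational point `RebasePos.flatPtQ`. -/
theorem rebaseSimplePos_flatPtQ (hF wF : (Fin 2 → ℚ) × ℚ) (hdet : RebasePos.detQ hF wF ≠ 0) (z : Fin (2 + 1 + 1) → ℝ) (h1 : SeparatePos.affB 2 1 hF z = 0) (h2 : SeparatePos.affB 2 1 wF z = 0) : z 0 = (RebasePos.flatPtQ hF wF 0 : ℝ) ∧ z 1 = (RebasePos.flatPtQ hF wF 1 : ℝ) :=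
  RebasePos.flatPtQ_spec hF wF hdet z h1 h2

end Summit.KontsevichZagierPeriods.ArrangementNormalForm.JanusBands
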